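import Literature.Analysis.ODE.PfaffianInvariance
import Literature.Analysis.ODE.LiouvilleFormula
import HarnessLib

/-!
# Pfaffian equations under a flow, II: the conformal factor and the transported `2`-form

Topic `Literature/Analysis/ODE`; continuation of `PfaffianInvariance.lean` (chart-level
infrastructure for the fact seat of `Literature.Geometry.Symplectic.Gompf1998_thm13_twoHandles`:
transport of the contact data of the levels of a `J`-convex function along the normalised
Liouville flow).  Everything is **proved**; no named fact.

Setting as there: `s ⊆ E`, a field `Z`, a solution `u : [0, T] → s` of `u' = Z(u)` and a
solution `J` of the linearised equation `J' = DZ(u t) ∘ J`.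

* §1 `eq_exp_smul_of_hasDerivWithinAt` — **the scalar linear equation**: if
  `g' = γ(t) • g` within `[0, T]` (`γ` continuous) then `g(t) = exp (∫₀ᵗ γ) • g(0)`;
  `oneForm_apply_linearization_eq_exp_mul` — hence, for a `1`-form `ω` with `ω(Z) ≡ 0` and
  `ι_Z dω = γ ω` on `s` (so `L_Z ω = γ ω`), **`ω(u t)(J t v) = m(t) ω(u 0)(J 0 v)` with the
  conformal factor `m(t) = exp (∫₀ᵗ γ(u τ) dτ) > 0` independent of `v`**: the flow of `Z` is
  "conformal" for `ω` on the transported vectors.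
* §2 `hasDerivWithinAt_twoForm_apply_linearization` — the derivative of
  `t ↦ Ω(u t)(J t a, J t b)` for a field of `2`-forms:
  `(D_Z Ω)(Ja, Jb) + Ω(DZ Ja, Jb) + Ω(Ja, DZ Jb)` (`= (L_Z Ω)(Ja, Jb)`).
* §3 `extDerivWithin_apply_triple` (Mathlib's `dΩ(x, y, z) = D_xΩ(y,z) - D_yΩ(x,z) + D_zΩ(x,y)`)
  and `lie_twoForm_apply_eq` — **`L_Z Ω = d(γ ω)` in coordinates** when `Ω = dω` is closed and
  `ι_Z Ω = γ ω`: `(L_Z Ω)(a, b) = (D_a γ) ω(b) - (D_b γ) ω(a) + γ Ω(a, b)`.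
* §4 `twoForm_oneForm_not_antipodal` — **the transported pair is never antipodal to the
  initial pair**: for `a` with `ω(u t)(J t a) ≡ 0` (a transported Legendrian direction) and any
  `b`, the pair `(Ω(u T)(J a, J b), ω(u T)(J b))` is not a negative multiple of
  `(Ω(u 0)(a', b'), ω(u 0)(b'))` (`a' = J 0 a`, `b' = J 0 b`) unless the latter vanishes:
  `H(t) = ω(u t)(J t b)` satisfies `H = m H(0)`, and `G(t) = Ω(u t)(J t a, J t b)` satisfies
  `G' = γ G + (D_{Ja} γ) H`, so `H(0) = 0` forces `H ≡ 0` and then `G = m G(0)`.  Downstream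
  this makes the straight-line homotopy between the twisting loop of a framed Legendrian knot
  and that of its transported image zero-free, whence equality of twisting numbers.

## References

* S. Lang, *Differential and Riemannian Manifolds*, GTM 160 (1995), Ch. IV §1 (linear
  equations, Prop. 1.9; the linearised flow, Thm. 1.14), Ch. V (Lie derivative and Cartan's
  formula `L_X = ι_X d + d ι_X`). [Lang1995]
* J. M. Lee, *Introduction to Smooth Manifolds*, 2nd ed. (2013), Thm. 14.35 (Cartan's magic
  formula). [LeeSmoothManifolds2013]
-/

noncomputable section

open Set Filter Metric
open scoped Topology NNReal

namespace Literature.Analysis.ODE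

variable {E : Type*} [NormedAddCommGroup E] [NormedSpace ℝ E]
  {F : Type*} [NormedAddCommGroup F] [NormedSpace ℝ F]

/-! ### §1 The scalar linear equation and the conformal factor -/

/-- **Solution of `g' = γ(t) • g`**: `g(t) = exp (∫₀ᵗ γ) • g(0)` on `[0, T]` for `γ` continuous
(the function `exp (-∫₀ᵗ γ) • g` has zero right derivative). [cite: Lang1995, Ch. IV §1, Prop. 1.9] -/
theorem eq_exp_smul_of_hasDerivWithinAt {g : ℝ → F} {γ : ℝ → ℝ} {T : ℝ}
    (hγ : ContinuousOn γ (Icc 0 T))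
    (hg : ∀ t ∈ Icc 0 T, HasDerivWithinAt g (γ t • g t) (Icc 0 T) t) :
    ∀ t ∈ Icc 0 T, g t = Real.exp (∫ τ in (0 : ℝ)..t, γ τ) • g 0 := by
  intro t ht
  have hT : 0 ≤ T := ht.1.trans ht.2
  set P : ℝ → ℝ := fun t => ∫ τ in (0 : ℝ)..t, γ τ with hP
  have hP' : ∀ t ∈ Ico 0 T, HasDerivWithinAt P (γ t) (Ici t) t := fun t ht =>
    hasDerivWithinAt_integral_of_continuousOn hγ ht
  have hPc : ContinuousOn P (Icc 0 T) := continuousOn_integral_of_continuousOn hT hγ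
  set φ : ℝ → F := fun t => Real.exp (-P t) • g t with hφ
  have hgc : ContinuousOn g (Icc 0 T) := fun t ht => (hg t ht).continuousWithinAt
  have hφc : ContinuousOn φ (Icc 0 T) := (hPc.neg.rexp).smul hgc
  have hφ' : ∀ t ∈ Ico 0 T, HasDerivWithinAt φ 0 (Ici t) t := by
    intro t ht
    have h1 : HasDerivWithinAt (fun t => Real.exp (-P t)) (Real.exp (-P t) * -γ t) (Ici t) t :=
      (hP' t ht).neg.exp
    have h2 := hasDerivWithinAt_Ici_of_Icc (hg t (Ico_subset_Icc_self ht)) ht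
    have h := h1.smul h2
    refine h.congr_deriv ?_
    rw [smul_smul, ← add_smul]
    have : Real.exp (-P t) * γ t + Real.exp (-P t) * -γ t = 0 := by ring
    rw [this, zero_smul]
  have hconst := constant_of_has_deriv_right_zero hφc hφ' t ht
  have hP0 : P 0 = 0 := by simp [hP]
  simp only [hφ, hP0, neg_zero, Real.exp_zero, one_smul] at hconst
  -- `exp (-P t) • g t = g 0`
  have hexp : Real.exp (P t) * Real.exp (-P t) = 1 := by rw [← Real.exp_add, add_neg_cancel, Real.exp_zero]
  calc g t = (Real.exp (P t) * Real.exp (-P t)) • g t := by rw [hexp, one_smul]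
    _ = Real.exp (P t) • (Real.exp (-P t) • g t) := by rw [mul_smul]
    _ = Real.exp (P t) • g 0 := by rw [hconst]

section OneForm

variable {ω : E → E [⋀^Fin 1]→L[ℝ] F} {Z : E → E} {s : Set E}

/-- **The conformal factor of a transported `1`-form.**  If `ω(Z) ≡ 0` on `s` and
`dω(q)(Z q, w) = γ(q) ω(q)(w)` (`ι_Z dω = γ ω`, i.e. `L_Z ω = γ ω`), `γ` continuous along the
trajectory, then along a solution `u` and its linearisation `J`:
`ω(u t)(J t v) = exp (∫₀ᵗ γ(u τ) dτ) • ω(u 0)(J 0 v)` — a positive factor, the same for all `v`.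
[cite: Lang1995, Ch. IV §1, Thm. 1.14] -/
theorem oneForm_apply_linearization_eq_exp_smul {γ : E → ℝ} {T : ℝ} {u : ℝ → E}
    {J : ℝ → E →L[ℝ] E} {Z' : E → E →L[ℝ] E}
    (hω : DifferentiableOn ℝ ω s) (hZ : ∀ q ∈ s, HasFDerivWithinAt Z (Z' q) s q)
    (hs : UniqueDiffOn ℝ s) (h0 : ∀ q ∈ s, ω q ![Z q] = 0)
    (hd : ∀ q ∈ s, ∀ w, extDerivWithin ω s q ![Z q, w] = γ q • ω q ![w])
    (hu : ∀ t ∈ Icc 0 T, HasDerivWithinAt u (Z (u t)) (Icc 0 T) t)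
    (hus : ∀ t ∈ Icc 0 T, u t ∈ s)
    (hJ : ∀ t ∈ Icc 0 T, HasDerivWithinAt J ((Z' (u t)).comp (J t)) (Icc 0 T) t)
    (hγ : ContinuousOn (fun t => γ (u t)) (Icc 0 T)) (v : E) :
    ∀ t ∈ Icc 0 T, ω (u t) ![J t v] = Real.exp (∫ τ in (0 : ℝ)..t, γ (u τ)) • ω (u 0) ![J 0 v] := by
  refine eq_exp_smul_of_hasDerivWithinAt hγ fun t ht => ?_
  -- the derivative of `t ↦ ω(u t)(J t v)` is `(L_Z ω)(u t)(J t v) = γ(u t) ω(u t)(J t v)`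
  set L : (E [⋀^Fin 1]→L[ℝ] F) ≃L[ℝ] (E →L[ℝ] F) :=
    (ContinuousAlternatingMap.ofSubsingletonLIE (𝕜 := ℝ) (E := E) (F := F)
      (0 : Fin 1)).symm.toContinuousLinearEquiv with hL
  have hLapply : ∀ (α : E [⋀^Fin 1]→L[ℝ] F) (w : E), L α w = α ![w] := fun α w => by
    have h1 : (ContinuousAlternatingMap.ofSubsingletonLIE (𝕜 := ℝ) (E := E) (F := F)
        (0 : Fin 1)) (L α) = α := by
      rw [hL]
      exact LinearIsometryEquiv.apply_symm_apply _ α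
    have h2 := congrArg (fun β : E [⋀^Fin 1]→L[ℝ] F => β ![w]) h1
    rw [← h2]
    rfl
  set Λ : E → E →L[ℝ] F := fun q => L (ω q) with hΛ
  set Λ' : E → E →L[ℝ] E →L[ℝ] F := fun q => (L : (E [⋀^Fin 1]→L[ℝ] F) →L[ℝ] E →L[ℝ] F).comp
    (fderivWithin ℝ ω s q) with hΛ'
  have hΛd : ∀ q ∈ s, HasFDerivWithinAt Λ (Λ' q) s q := fun q hq =>
    (L : (E [⋀^Fin 1]→L[ℝ] F) →L[ℝ] E →L[ℝ] F).hasFDerivAt.comp_hasFDerivWithinAt q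
      (hω q hq).hasFDerivWithinAt
  have h := hasDerivWithinAt_apply_linearization hΛd hu hus hJ v ht
  have hlie : Λ' (u t) (Z (u t)) (J t v) + Λ (u t) (Z' (u t) (J t v)) = γ (u t) • Λ (u t) (J t v) := by
    simp only [hΛ', hΛ, ContinuousLinearMap.coe_comp, Function.comp_apply,
      ContinuousLinearEquiv.coe_coe, hLapply]
    rw [← hd _ (hus t ht), extDerivWithin_apply_eq_lie ((hω _ (hus t ht)).hasFDerivWithinAt)
      (hZ _ (hus t ht)) (hs _ (hus t ht)) (hus t ht) h0]
  rw [hlie] at h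
  simp only [hΛ, hLapply] at h
  exact h

/-- **The conformal factor, multiplicative form**: `ω(u t)(J t v) = m(t) * ω(u 0)(J 0 v)` with
one `m(t) > 0` for all `v` (scalar-valued forms). [cite: Lang1995, Ch. IV §1, Thm. 1.14] -/
theorem oneForm_apply_linearization_eq_pos_mul {ω : E → E [⋀^Fin 1]→L[ℝ] ℝ} {γ : E → ℝ} {T : ℝ}
    {u : ℝ → E} {J : ℝ → E →L[ℝ] E} {Z' : E → E →L[ℝ] E}
    (hω : DifferentiableOn ℝ ω s) (hZ : ∀ q ∈ s, HasFDerivWithinAt Z (Z' q) s q)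
    (hs : UniqueDiffOn ℝ s) (h0 : ∀ q ∈ s, ω q ![Z q] = 0)
    (hd : ∀ q ∈ s, ∀ w, extDerivWithin ω s q ![Z q, w] = γ q • ω q ![w])
    (hu : ∀ t ∈ Icc 0 T, HasDerivWithinAt u (Z (u t)) (Icc 0 T) t)
    (hus : ∀ t ∈ Icc 0 T, u t ∈ s)
    (hJ : ∀ t ∈ Icc 0 T, HasDerivWithinAt J ((Z' (u t)).comp (J t)) (Icc 0 T) t)
    (hγ : ContinuousOn (fun t => γ (u t)) (Icc 0 T)) {t : ℝ} (ht : t ∈ Icc 0 T) :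
    ∃ m : ℝ, 0 < m ∧ ∀ v, ω (u t) ![J t v] = m * ω (u 0) ![J 0 v] :=
  ⟨Real.exp (∫ τ in (0 : ℝ)..t, γ (u τ)), Real.exp_pos _, fun v =>
    oneForm_apply_linearization_eq_exp_smul hω hZ hs h0 hd hu hus hJ hγ v t ht⟩

end OneForm

/-! ### §2 The derivative of a transported `2`-form -/

section TwoForm

variable {Ω : E → E [⋀^Fin 2]→L[ℝ] F} {Z : E → E} {Z' : E → E →L[ℝ] E} {s : Set E} {T : ℝ}
  {u : ℝ → E} {J : ℝ → E →L[ℝ] E}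

omit [NormedAddCommGroup E] [NormedSpace ℝ E] in
/-- Updating the first entry of a pair. [folklore] -/
theorem update_pair_zero (a b c : E) : Function.update ![a, b] 0 c = ![c, b] := by
  funext i
  fin_cases i <;> rfl

omit [NormedAddCommGroup E] [NormedSpace ℝ E] in
/-- Updating the second entry of a pair. [folklore] -/
theorem update_pair_one (a b c : E) : Function.update ![a, b] 1 c = ![a, c] := by
  funext i
  fin_cases i <;> rfl

/-- Evaluating the linear map `M(·, y)` attached to the first slot of a `2`-form. [folklore] -/
theorem toCLM_vec2_zero (M : E [⋀^Fin 2]→L[ℝ] F) (x y c : E) :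
    M.toContinuousLinearMap (fun i => (![x, y] : Fin 2 → E) i) 0 c = M ![c, y] := by
  rw [ContinuousAlternatingMap.toContinuousLinearMap,
    ContinuousMultilinearMap.toContinuousLinearMap_apply]
  show M (Function.update ![x, y] 0 c) = _
  rw [update_pair_zero]

/-- Evaluating the linear map `M(x, ·)` attached to the second slot of a `2`-form. [folklore] -/
theorem toCLM_vec2_one (M : E [⋀^Fin 2]→L[ℝ] F) (x y c : E) :
    M.toContinuousLinearMap (fun i => (![x, y] : Fin 2 → E) i) 1 c = M ![x, c] := by
  rw [ContinuousAlternatingMap.toContinuousLinearMap,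
    ContinuousMultilinearMap.toContinuousLinearMap_apply]
  show M (Function.update ![x, y] 1 c) = _
  rw [update_pair_one]

/-- **The derivative of `t ↦ Ω(u t)(J t a, J t b)`** along a solution and its linearisation:
`(D_{Z(u t)} Ω)(J a, J b) + Ω(DZ(J a), J b) + Ω(J a, DZ(J b))` — the coordinate expression of
`(L_Z Ω)(Ja, Jb)`. [cite: Lang1995, Ch. IV §1, Thm. 1.14] -/
theorem hasDerivWithinAt_twoForm_apply_linearization {Ω' : E → E →L[ℝ] E [⋀^Fin 2]→L[ℝ] F}
    (hΩ : ∀ q ∈ s, HasFDerivWithinAt Ω (Ω' q) s q)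
    (hu : ∀ t ∈ Icc 0 T, HasDerivWithinAt u (Z (u t)) (Icc 0 T) t)
    (hus : ∀ t ∈ Icc 0 T, u t ∈ s)
    (hJ : ∀ t ∈ Icc 0 T, HasDerivWithinAt J ((Z' (u t)).comp (J t)) (Icc 0 T) t)
    (a b : E) {t : ℝ} (ht : t ∈ Icc 0 T) :
    HasDerivWithinAt (fun t => Ω (u t) ![J t a, J t b])
      (Ω' (u t) (Z (u t)) ![J t a, J t b] + Ω (u t) ![Z' (u t) (J t a), J t b] +
        Ω (u t) ![J t a, Z' (u t) (J t b)]) (Icc 0 T) t := by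
  have h1 : HasDerivWithinAt (fun t => Ω (u t)) (Ω' (u t) (Z (u t))) (Icc 0 T) t :=
    (hΩ _ (hus t ht)).comp_hasDerivWithinAt t (hu t ht) fun t' ht' => hus t' ht'
  have h2a : HasDerivWithinAt (fun t => J t a) (Z' (u t) (J t a)) (Icc 0 T) t := by
    simpa using (hJ t ht).clm_apply (hasDerivWithinAt_const t (Icc 0 T) a)
  have h2b : HasDerivWithinAt (fun t => J t b) (Z' (u t) (J t b)) (Icc 0 T) t := by
    simpa using (hJ t ht).clm_apply (hasDerivWithinAt_const t (Icc 0 T) b)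
  -- Fréchet form of the product rule for the evaluation of a `2`-form on two moving vectors
  have h := h1.hasFDerivWithinAt.continuousAlternatingMap_apply
    (g := fun (i : Fin 2) t => (![J t a, J t b] : Fin 2 → E) i)
    (g' := ![ContinuousLinearMap.toSpanSingleton ℝ (Z' (u t) (J t a)),
      ContinuousLinearMap.toSpanSingleton ℝ (Z' (u t) (J t b))])
    (fun i => by
      fin_cases i
      · exact h2a.hasFDerivWithinAt
      · exact h2b.hasFDerivWithinAt)
  have h' := h.hasDerivWithinAt
  refine h'.congr_deriv ?_
  rw [Fin.sum_univ_two]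
  simp only [add_apply, ContinuousLinearMap.coe_comp, Function.comp_apply,
    ContinuousLinearMap.toSpanSingleton_apply, one_smul, ContinuousAlternatingMap.apply_apply,
    Matrix.cons_val_zero, Matrix.cons_val_one, Matrix.cons_val_fin_one]
  rw [toCLM_vec2_zero, toCLM_vec2_one, add_assoc]

end TwoForm

/-! ### §3 `L_Z Ω = d(γ ω)` in coordinates, for `Ω = dω` closed and `ι_Z Ω = γ ω` -/

section Identity

variable {Ω : E → E [⋀^Fin 2]→L[ℝ] F} {ω : E → E [⋀^Fin 1]→L[ℝ] F} {Z : E → E}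
  {s : Set E} {q : E}

omit [NormedAddCommGroup E] [NormedSpace ℝ E] in
/-- `Fin.removeNth` on a triple, first entry. [folklore] -/
theorem removeNth_zero_triple (a b c : E) : Fin.removeNth (0 : Fin 3) ![a, b, c] = ![b, c] := by
  funext i; fin_cases i <;> rfl

omit [NormedAddCommGroup E] [NormedSpace ℝ E] in
/-- `Fin.removeNth` on a triple, second entry. [folklore] -/
theorem removeNth_one_triple (a b c : E) : Fin.removeNth (1 : Fin 3) ![a, b, c] = ![a, c] := by
  funext i; fin_cases i <;> rfl

omit [NormedAddCommGroup E] [NormedSpace ℝ E] in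
/-- `Fin.removeNth` on a triple, third entry. [folklore] -/
theorem removeNth_two_triple (a b c : E) : Fin.removeNth (2 : Fin 3) ![a, b, c] = ![a, b] := by
  funext i; fin_cases i <;> rfl

/-- Mathlib's exterior derivative of a `2`-form on a triple:
`dΩ(q)(x, y, z) = D_xΩ(y, z) - D_yΩ(x, z) + D_zΩ(x, y)`. [folklore] -/
theorem extDerivWithin_apply_triple (hΩ : DifferentiableWithinAt ℝ Ω s q)
    (hs : UniqueDiffWithinAt ℝ s q) (x y z : E) :
    extDerivWithin Ω s q ![x, y, z] =
      fderivWithin ℝ Ω s q x ![y, z] - fderivWithin ℝ Ω s q y ![x, z] +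
        fderivWithin ℝ Ω s q z ![x, y] := by
  rw [extDerivWithin_apply hΩ hs, Fin.sum_univ_three]
  simp only [Fin.val_zero, pow_zero, one_smul, Matrix.cons_val_zero, Fin.val_one, pow_one,
    neg_smul, Matrix.cons_val_one, Fin.val_two, Matrix.cons_val]
  rw [removeNth_zero_triple, removeNth_one_triple, removeNth_two_triple,
    fderivWithin_continuousAlternatingMap_apply_const hs hΩ,
    fderivWithin_continuousAlternatingMap_apply_const hs hΩ,
    fderivWithin_continuousAlternatingMap_apply_const hs hΩ]
  simp only [ContinuousLinearMap.flipAlternating_apply_apply, even_two, Even.neg_pow, one_pow,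
    one_smul]
  abel

/-- A `2`-form is antisymmetric on pairs. [folklore] -/
theorem twoForm_swap (M : E [⋀^Fin 2]→L[ℝ] F) (x y : E) : M ![y, x] = -M ![x, y] := by
  have h := M.map_swap ![x, y] (i := 0) (j := 1) (by decide)
  have hv : (![x, y] : Fin 2 → E) ∘ Equiv.swap (0 : Fin 2) 1 = ![y, x] := by
    funext i; fin_cases i <;> rfl
  rw [hv] at h
  exact h

/-- **The derivative of `ι_Z Ω = γ ω` in a direction `x`** (product rules):
`(D_xΩ)(Z, w) + Ω(DZ x, w) = (D_x γ) ω(w) + γ (D_x ω)(w)`. [folklore] -/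
theorem fderivWithin_contract_eq {γ : E → ℝ} {Ω' : E →L[ℝ] E [⋀^Fin 2]→L[ℝ] F}
    {ω' : E →L[ℝ] E [⋀^Fin 1]→L[ℝ] F} {Z' : E →L[ℝ] E} {γ' : E →L[ℝ] ℝ}
    (hΩ : HasFDerivWithinAt Ω Ω' s q) (hω : HasFDerivWithinAt ω ω' s q)
    (hZ : HasFDerivWithinAt Z Z' s q) (hγ : HasFDerivWithinAt γ γ' s q)
    (hs : UniqueDiffWithinAt ℝ s q) (hq : q ∈ s)
    (hc : ∀ q' ∈ s, ∀ w, Ω q' ![Z q', w] = γ q' • ω q' ![w]) (x w : E) :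
    Ω' x ![Z q, w] + Ω q ![Z' x, w] = γ' x • ω q ![w] + γ q • ω' x ![w] := by
  -- left-hand side: derivative of `q' ↦ Ω q' ![Z q', w]`
  have hL := hΩ.continuousAlternatingMap_apply
    (g := fun (i : Fin 2) q' => (![Z q', w] : Fin 2 → E) i) (g' := ![Z', 0]) (fun i => by
      fin_cases i
      · exact hZ
      · exact hasFDerivWithinAt_const w q s)
  -- right-hand side: derivative of `q' ↦ γ q' • ω q' ![w]`, which agrees with it on `s`
  have hR : HasFDerivWithinAt (fun q' => γ q' • ω q' ![w])
      (γ q • ω'.flipAlternating ![w] + γ'.smulRight (ω q ![w])) s q :=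
    hγ.smul (hω.continuousAlternatingMap_apply_const ![w])
  have hR' : HasFDerivWithinAt (fun q' => Ω q' fun i => (![Z q', w] : Fin 2 → E) i)
      (γ q • ω'.flipAlternating ![w] + γ'.smulRight (ω q ![w])) s q :=
    hR.congr (fun q' hq' => by show Ω q' ![Z q', w] = _; exact hc q' hq' w)
      (by show Ω q ![Z q, w] = _; exact hc q hq w)
  have h3 := DFunLike.congr_fun (hs.eq hL hR') x
  simp only [Fin.sum_univ_two, add_apply, ContinuousLinearMap.coe_comp,
    Function.comp_apply, ContinuousAlternatingMap.apply_apply, Matrix.cons_val_zero,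
    Matrix.cons_val_one, Matrix.cons_val_fin_one, zero_apply,
    smul_apply, ContinuousLinearMap.smulRight_apply,
    ContinuousLinearMap.flipAlternating_apply_apply] at h3
  -- the two correction terms of the product rule
  have h4 : (Ω q).toContinuousLinearMap (fun i => (![Z q, w] : Fin 2 → E) i) 0 (Z' x) =
      Ω q ![Z' x, w] := by
    rw [ContinuousAlternatingMap.toContinuousLinearMap,
      ContinuousMultilinearMap.toContinuousLinearMap_apply]
    show Ω q (Function.update ![Z q, w] 0 (Z' x)) = Ω q ![Z' x, w]
    rw [update_pair_zero]
  have h5 : (Ω q).toContinuousLinearMap (fun i => (![Z q, w] : Fin 2 → E) i) 1 0 = 0 := by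
    rw [ContinuousAlternatingMap.toContinuousLinearMap,
      ContinuousMultilinearMap.toContinuousLinearMap_apply]
    show Ω q (Function.update ![Z q, w] 1 0) = 0
    rw [update_pair_one]
    exact (Ω q).map_coord_zero 1 rfl
  have h6 : (Ω' x fun i => (![Z q, w] : Fin 2 → E) i) = Ω' x ![Z q, w] := rfl
  rw [h4, h5, h6, add_zero] at h3
  rw [h3, add_comm]

/-- **`L_Z Ω = d(γ ω)` in coordinates.**  At a point `q ∈ s` let the field of `2`-forms `Ω` be
closed (`dΩ(q) = 0`), equal to `dω` at `q`, and satisfy `ι_Z Ω = γ ω` on `s`.  Then for all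
`a, b`:
`(D_{Z q}Ω)(a, b) + Ω(DZ a, b) + Ω(a, DZ b) = (D_a γ) ω(b) - (D_b γ) ω(a) + γ Ω(a, b)`.
Left: the coordinate Lie derivative `(L_Z Ω)(a, b)`; by closedness (the cyclic identity
`extDerivWithin_apply_triple = 0`) it equals `d(ι_Z Ω)(a, b)` (Cartan), and
`d(γ ω) = dγ ∧ ω + γ dω` with `dω = Ω`. [cite: LeeSmoothManifolds2013, Thm. 14.35] -/
theorem lie_twoForm_apply_eq {γ : E → ℝ} {Ω' : E →L[ℝ] E [⋀^Fin 2]→L[ℝ] F}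
    {ω' : E →L[ℝ] E [⋀^Fin 1]→L[ℝ] F} {Z' : E →L[ℝ] E} {γ' : E →L[ℝ] ℝ}
    (hΩ : HasFDerivWithinAt Ω Ω' s q) (hω : HasFDerivWithinAt ω ω' s q)
    (hZ : HasFDerivWithinAt Z Z' s q) (hγ : HasFDerivWithinAt γ γ' s q)
    (hs : UniqueDiffWithinAt ℝ s q) (hq : q ∈ s)
    (hclosed : extDerivWithin Ω s q = 0)
    (hc : ∀ q' ∈ s, ∀ w, Ω q' ![Z q', w] = γ q' • ω q' ![w])
    (hdω : extDerivWithin ω s q = Ω q) (a b : E) :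
    Ω' (Z q) ![a, b] + Ω q ![Z' a, b] + Ω q ![a, Z' b] =
      γ' a • ω q ![b] - γ' b • ω q ![a] + γ q • Ω q ![a, b] := by
  -- the cyclic identity from `dΩ = 0`
  have hcyc : Ω' (Z q) ![a, b] = Ω' a ![Z q, b] - Ω' b ![Z q, a] := by
    have h := extDerivWithin_apply_triple hΩ.differentiableWithinAt hs (Z q) a b
    rw [hclosed, hΩ.fderivWithin hs] at h
    have h' : Ω' (Z q) ![a, b] - Ω' a ![Z q, b] + Ω' b ![Z q, a] = 0 := by
      simpa using h.symm
    rw [← sub_eq_zero]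
    rw [← h']
    abel
  -- the derivative of `ι_Z Ω = γ ω` in the directions `a` and `b`
  have ha := fderivWithin_contract_eq hΩ hω hZ hγ hs hq hc a b
  have hb := fderivWithin_contract_eq hΩ hω hZ hγ hs hq hc b a
  -- `dω = Ω` on the pair `(a, b)`
  have hd : ω' a ![b] - ω' b ![a] = Ω q ![a, b] := by
    rw [← hdω, extDerivWithin_apply_pair hω.differentiableWithinAt hs, hω.fderivWithin hs]
  rw [hcyc, twoForm_swap (Ω q) (Z' b) a, ← hd, smul_sub]
  -- linear bookkeeping
  have ha' : Ω' a ![Z q, b] = γ' a • ω q ![b] + γ q • ω' a ![b] - Ω q ![Z' a, b] :=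
    eq_sub_of_add_eq ha
  have hb' : Ω' b ![Z q, a] = γ' b • ω q ![a] + γ q • ω' b ![a] - Ω q ![Z' b, a] :=
    eq_sub_of_add_eq hb
  rw [ha', hb']
  abel

end Identity

/-! ### §4 The transported pair `(Ω(Ja, Jb), ω(Jb))` is never antipodal to the initial pair -/

section Antipodal

variable {Ω : E → E [⋀^Fin 2]→L[ℝ] ℝ} {ω : E → E [⋀^Fin 1]→L[ℝ] ℝ} {Z : E → E}
  {Z' : E → E →L[ℝ] E} {γ : E → ℝ} {s : Set E} {T : ℝ} {u : ℝ → E} {J : ℝ → E →L[ℝ] E}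

/-- **The transported pair is never a negative multiple of the initial pair.**  Let `ω` be a
field of `1`-forms and `Ω = dω` its (closed) differential on `s`, `Z` a field with `ω(Z) ≡ 0`
and `ι_Z Ω = γ ω` on `s` (`γ` differentiable, continuous along the trajectory), `u` a solution of
`u' = Z(u)` on `[0, T]` in `s` and `J` its linearisation.  For vectors `a, b` with
`ω(u 0)(J 0 a) = 0`, put `G(t) = Ω(u t)(J t a, J t b)` and `H(t) = ω(u t)(J t b)`.  If
`(G(T), H(T)) = -μ (G(0), H(0))` for some `μ > 0` then `G(0) = H(0) = 0`.  Indeed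
`H(T) = m H(0)` with `m > 0` (`oneForm_apply_linearization_eq_exp_smul`) forces `H(0) = 0`,
hence `H ≡ 0`; the direction `a` stays in `ker ω` (`oneForm_apply_linearization_eq_zero`); so
`G' = (L_Z Ω)(Ja, Jb) = (D_{Ja}γ) H - (D_{Jb}γ) ω(Ja) + γ G = γ G` (`lie_twoForm_apply_eq`),
whence `G(T) = m' G(0)` with `m' > 0` and `G(0) = 0`. [cite: Lang1995, Ch. IV §1, Thm. 1.14] -/
theorem twoForm_oneForm_not_antipodal
    (hΩ : DifferentiableOn ℝ Ω s) (hω : DifferentiableOn ℝ ω s)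
    (hZ : ∀ q ∈ s, HasFDerivWithinAt Z (Z' q) s q) (hγ : DifferentiableOn ℝ γ s)
    (hs : UniqueDiffOn ℝ s) (h0 : ∀ q ∈ s, ω q ![Z q] = 0)
    (hclosed : ∀ q ∈ s, extDerivWithin Ω s q = 0)
    (hc : ∀ q ∈ s, ∀ w, Ω q ![Z q, w] = γ q • ω q ![w])
    (hdω : ∀ q ∈ s, extDerivWithin ω s q = Ω q)
    (hu : ∀ t ∈ Icc 0 T, HasDerivWithinAt u (Z (u t)) (Icc 0 T) t)
    (hus : ∀ t ∈ Icc 0 T, u t ∈ s)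
    (hJ : ∀ t ∈ Icc 0 T, HasDerivWithinAt J ((Z' (u t)).comp (J t)) (Icc 0 T) t)
    (hγu : ContinuousOn (fun t => γ (u t)) (Icc 0 T)) (hT : 0 ≤ T)
    {a b : E} (ha : ω (u 0) ![J 0 a] = 0) {μ : ℝ} (hμ : 0 < μ)
    (hG : Ω (u T) ![J T a, J T b] = -μ * Ω (u 0) ![J 0 a, J 0 b])
    (hH : ω (u T) ![J T b] = -μ * ω (u 0) ![J 0 b]) :
    Ω (u 0) ![J 0 a, J 0 b] = 0 ∧ ω (u 0) ![J 0 b] = 0 := by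
  have hTm : T ∈ Icc 0 T := ⟨hT, le_rfl⟩
  -- `ι_Z dω = γ ω` in the form needed by the `1`-form lemmas
  have hd : ∀ q ∈ s, ∀ w, extDerivWithin ω s q ![Z q, w] = γ q • ω q ![w] := fun q hq w => by
    rw [hdω q hq]; exact hc q hq w
  -- `|γ ∘ u|` is bounded on `[0, T]`
  obtain ⟨K, hK⟩ := isCompact_Icc.exists_bound_of_continuousOn hγu
  have hK' : ∀ t ∈ Icc 0 T, |γ (u t)| ≤ K := fun t ht => by
    have := hK t ht; rwa [Real.norm_eq_abs] at this
  -- the direction `a` stays in `ker ω`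
  have hat : ∀ t ∈ Icc 0 T, ω (u t) ![J t a] = 0 :=
    oneForm_apply_linearization_eq_zero hω hZ hs h0 hd hu hus hJ hK' ha
  -- `H(T) = m H(0)`, so `H(0) = 0`
  obtain ⟨m, hm, hmH⟩ := oneForm_apply_linearization_eq_pos_mul hω hZ hs h0 hd hu hus hJ hγu hTm
  have hH0 : ω (u 0) ![J 0 b] = 0 := by
    have h1 := hmH b
    rw [hH] at h1
    have h2 : (m + μ) * ω (u 0) ![J 0 b] = 0 := by linarith
    rcases mul_eq_zero.1 h2 with h | h
    · linarith
    · exact h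
  -- hence `H ≡ 0`
  have hHt : ∀ t ∈ Icc 0 T, ω (u t) ![J t b] = 0 :=
    oneForm_apply_linearization_eq_zero hω hZ hs h0 hd hu hus hJ hK' hH0
  -- `G' = γ G`
  have hG' : ∀ t ∈ Icc 0 T, HasDerivWithinAt (fun t => Ω (u t) ![J t a, J t b])
      (γ (u t) • Ω (u t) ![J t a, J t b]) (Icc 0 T) t := by
    intro t ht
    have hq := hus t ht
    have h := hasDerivWithinAt_twoForm_apply_linearization
      (fun q hq => (hΩ q hq).hasFDerivWithinAt) hu hus hJ a b ht
    have hid := lie_twoForm_apply_eq (hΩ _ hq).hasFDerivWithinAt (hω _ hq).hasFDerivWithinAt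
      (hZ _ hq) (hγ _ hq).hasFDerivWithinAt (hs _ hq) hq (hclosed _ hq) hc (hdω _ hq)
      (J t a) (J t b)
    rw [hid, hat t ht, hHt t ht, smul_zero, smul_zero, sub_zero, zero_add] at h
    exact h
  have hGexp := eq_exp_smul_of_hasDerivWithinAt hγu hG' T hTm
  simp only [smul_eq_mul] at hGexp
  refine ⟨?_, hH0⟩
  set m' := Real.exp (∫ τ in (0 : ℝ)..T, γ (u τ)) with hm'
  have hm'pos : 0 < m' := Real.exp_pos _
  rw [hG] at hGexp
  have h2 : (m' + μ) * Ω (u 0) ![J 0 a, J 0 b] = 0 := by linarith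
  rcases mul_eq_zero.1 h2 with h | h
  · linarith
  · exact h

end Antipodal

end Literature.Analysis.ODE

end
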